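import Summits.CriticalPhenomena.PercolationContinuityZ3.Theses.PercLevyKhintchine
import HarnessLib

/-!
# `PercLevyKhintchine.SmallPNegType` (stmt-CriticalPhenomena-2171) — kernel lemmas I: `ℓ¹` is of negative type on `ℤ³`,
# its null directions, and the positive kernels `r^{‖x−y‖₁}`

RSW3 lane (lead, gen 30).  Helper lemmas for item `stmt-CriticalPhenomena-2171` of route `CriticalPhenomena/PercLevyKhintchine`
(`(ID)` for small `p`: for a fixed finite family `x` and `p < p₀(x)`, `Σ c_i c_j log τ_p(x_i,x_j) ≥ 0` whenever `Σ c_i = 0`).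
As `p → 0`, `log τ_p(x,y) = ‖x−y‖₁ log p + log N(x−y) + O(p)` with `N(v) = ‖v‖₁! / Π_k |v_k|!` the number of `ℓ¹`-geodesics,
so `Σ c_i c_j log τ_p = |log p| · (−Σ c_i c_j ‖x_i − x_j‖₁) + Σ c_i c_j log N(x_i − x_j) + O(p)`.  This file (part I,
pure finite-dimensional algebra) and its sequel `…SmallPNegTypeLogKernels` (part II, one-variable calculus) prove the two
structural facts behind the positivity of the right-hand side; no percolation is used.  Part I:

* `sum_sum_mul_l1_nonpos` — `ℓ¹` IS OF NEGATIVE TYPE on `ℤ³`: `Σ c_i c_j ‖x_i − x_j‖₁ ≤ 0` when `Σ c_i = 0` (cut decomposition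
  `|a−b| = Σ_t (1[a≤t] − 1[b≤t])²`, `sum_sum_mul_abs_sub_eq`);
* `levelSum_eq_zero_of_l1Form_eq_zero` — its NULL DIRECTIONS are the `c` all of whose axis-level sums `Σ_{i : x_i k = v} c_i`
  vanish, and there every kernel of one coordinate pair vanishes (`sum_sum_coord_eq_zero`; in particular the `Π_k |v_k|!` part
  of `log N`);
* `sum_sum_mul_pow_l1_nonneg` — `r^{‖x−y‖₁}` (`|r| ≤ 1`) is POSITIVE SEMI-DEFINITE (explicit Gram expansion `pow_dist_eq_sum_gram`
  in each coordinate, Schur product by expansion).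
Part II deduces: `1/(1+μ‖x−y‖₁)` positive semi-definite, `log(1+λ‖x−y‖₁)` of negative type, and `Σ c_i c_j log(‖x_i − x_j‖₁!) ≥ 0`
on the null directions.  No definitions, no sorries.

References: M. Deza, M. Laurent, *Geometry of Cuts and Metrics* (1997), §6.1 (`ℓ¹` and cut semimetrics are of negative type)
[DezaLaurent1997]; I. J. Schoenberg (1938) [Schoenberg1938]; C. Berg, J. P. R. Christensen, P. Ressel, *Harmonic Analysis on
Semigroups* (1984), Ch. 3 §§1–2, Ch. 4 §4 [BergChristensenRessel1984].
-/

noncomputable section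

namespace Summit.CriticalPhenomena.PercolationContinuityZ3.Theorems

namespace SmallPNegType

open Finset Literature.Probability.LatticeModels

/-! ### One dimension: the cut decomposition of `|a − b|` -/

/-- The cut decomposition of the distance on `ℤ`: for `a, b ∈ [m, M)`,
`|a − b| = Σ_{t ∈ [m, M)} (1[a ≤ t] − 1[b ≤ t])²`. [cite: DezaLaurent1997, §4.2 (cut semimetrics on the line)] -/
theorem abs_sub_eq_sum_sq_indicator {a b m M : ℤ} (ha : m ≤ a) (haM : a < M) (hb : m ≤ b) (hbM : b < M) :
    (|a - b| : ℝ) = ∑ t ∈ Finset.Ico m M,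
      ((if a ≤ t then (1 : ℝ) else 0) - (if b ≤ t then (1 : ℝ) else 0)) ^ 2 := by
  wlog hab : a ≤ b generalizing a b
  · have h := this hb hbM ha haM (le_of_not_ge hab)
    rw [abs_sub_comm, h]
    exact Finset.sum_congr rfl fun t _ => by ring
  have hsum : ∀ t ∈ Finset.Ico m M, ((if a ≤ t then (1 : ℝ) else 0) - (if b ≤ t then (1 : ℝ) else 0)) ^ 2 =
      if t ∈ Finset.Ico a b then (1 : ℝ) else 0 := by
    intro t _
    by_cases h1 : a ≤ t <;> by_cases h2 : b ≤ t
    · simp [h1, h2, Finset.mem_Ico, not_lt.2 h2]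
    · simp [h1, h2, Finset.mem_Ico, not_le.1 h2]
    · exact absurd (hab.trans h2) h1
    · simp [h1, h2, Finset.mem_Ico]
  rw [Finset.sum_congr rfl hsum, Finset.sum_ite_mem, Finset.inter_eq_right.2 (Finset.Ico_subset_Ico ha hbM.le),
    Finset.sum_const, nsmul_eq_mul, mul_one, Int.card_Ico]
  have habR : (a : ℝ) ≤ b := by exact_mod_cast hab
  rw [abs_of_nonpos (by linarith)]
  have : (((b - a).toNat : ℕ) : ℝ) = (b : ℝ) - a := by
    rw [show (((b - a).toNat : ℕ) : ℝ) = (((b - a).toNat : ℤ) : ℝ) by norm_cast, Int.toNat_of_nonneg (by linarith)]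
    push_cast; ring
  rw [this]; ring

/-- For weights of total mass zero, `Σ_{i,j} c_i c_j (u_i − u_j)² = −2 (Σ_i c_i u_i)²`. [folklore] -/
theorem sum_sum_mul_sq_sub_eq {n : ℕ} (c u : Fin n → ℝ) (hc : ∑ i, c i = 0) :
    ∑ i, ∑ j, c i * c j * (u i - u j) ^ 2 = -2 * (∑ i, c i * u i) ^ 2 := by
  have h : ∀ i j, c i * c j * (u i - u j) ^ 2 =
      (c i * u i ^ 2) * c j + c i * (c j * u j ^ 2) - 2 * ((c i * u i) * (c j * u j)) := by
    intro i j; ring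
  have e1 : ∑ i, ∑ j, (c i * u i ^ 2) * c j = (∑ i, c i * u i ^ 2) * ∑ j, c j := by rw [Finset.sum_mul_sum]
  have e2 : ∑ i, ∑ j, c i * (c j * u j ^ 2) = (∑ i, c i) * ∑ j, c j * u j ^ 2 := by rw [Finset.sum_mul_sum]
  have e3 : ∑ i, ∑ j, 2 * ((c i * u i) * (c j * u j)) = 2 * ((∑ i, c i * u i) * ∑ j, c j * u j) := by
    rw [Finset.sum_mul_sum, Finset.mul_sum]
    refine Finset.sum_congr rfl fun i _ => ?_
    rw [Finset.mul_sum]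
  simp only [h, Finset.sum_add_distrib, Finset.sum_sub_distrib, e1, e2, e3, hc]
  ring

/-- **`ℤ` with `|a − b|` is of negative type**: `Σ_{i,j} c_i c_j |a_i − a_j| ≤ 0` whenever `Σ c_i = 0`; precisely it equals
`−2 Σ_t (Σ_i c_i 1[a_i ≤ t])²` over a window of cuts containing all the points.
[cite: DezaLaurent1997, §6.1] -/
theorem sum_sum_mul_abs_sub_eq {n : ℕ} (a : Fin n → ℤ) (c : Fin n → ℝ) (hc : ∑ i, c i = 0) {m M : ℤ}
    (hm : ∀ i, m ≤ a i) (hM : ∀ i, a i < M) :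
    ∑ i, ∑ j, c i * c j * (|a i - a j| : ℝ) =
      -2 * ∑ t ∈ Finset.Ico m M, (∑ i, c i * (if a i ≤ t then (1 : ℝ) else 0)) ^ 2 := by
  have h1 : ∀ i j, c i * c j * (|a i - a j| : ℝ) = ∑ t ∈ Finset.Ico m M,
      c i * c j * ((if a i ≤ t then (1 : ℝ) else 0) - (if a j ≤ t then (1 : ℝ) else 0)) ^ 2 := by
    intro i j
    rw [abs_sub_eq_sum_sq_indicator (hm i) (hM i) (hm j) (hM j), Finset.mul_sum]
  simp_rw [h1, Finset.sum_comm (s := Finset.univ) (t := Finset.Ico m M)]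
  rw [Finset.mul_sum]
  refine Finset.sum_congr rfl fun t _ => ?_
  exact sum_sum_mul_sq_sub_eq c (fun i => if a i ≤ t then (1 : ℝ) else 0) hc

/-- `ℤ` is of negative type (inequality form). [cite: DezaLaurent1997, §6.1] -/
theorem sum_sum_mul_abs_sub_nonpos {n : ℕ} (a : Fin n → ℤ) (c : Fin n → ℝ) (hc : ∑ i, c i = 0) :
    ∑ i, ∑ j, c i * c j * (|a i - a j| : ℝ) ≤ 0 := by
  set B : ℤ := ∑ i, |a i| with hB
  have hle : ∀ i, |a i| ≤ B := fun i => Finset.single_le_sum (f := fun i => |a i|) (fun i _ => abs_nonneg _) (Finset.mem_univ i)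
  rw [sum_sum_mul_abs_sub_eq a c hc (m := -B) (M := B + 1) (fun i => by linarith [hle i, neg_abs_le (a i)])
    (fun i => by linarith [hle i, le_abs_self (a i)])]
  have : 0 ≤ ∑ t ∈ Finset.Ico (-B) (B + 1), (∑ i, c i * (if a i ≤ t then (1 : ℝ) else 0)) ^ 2 :=
    Finset.sum_nonneg fun t _ => sq_nonneg _
  linarith

/-! ### Three dimensions: `ℓ¹` is of negative type on `ℤ³`, and its null directions -/

/-- Splitting the `ℓ¹` form into its three coordinate forms. [folklore] -/
theorem sum_sum_mul_sum_eq_sum_coord {n : ℕ} (x : Fin n → Site 3) (c : Fin n → ℝ) :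
    ∑ i, ∑ j, c i * c j * (∑ k, (|x i k - x j k| : ℝ)) = ∑ k, ∑ i, ∑ j, c i * c j * (|x i k - x j k| : ℝ) := by
  calc ∑ i, ∑ j, c i * c j * (∑ k, (|x i k - x j k| : ℝ))
      = ∑ i, ∑ j, ∑ k, c i * c j * (|x i k - x j k| : ℝ) :=
        Finset.sum_congr rfl fun i _ => Finset.sum_congr rfl fun j _ => by rw [Finset.mul_sum]
    _ = ∑ i, ∑ k, ∑ j, c i * c j * (|x i k - x j k| : ℝ) := Finset.sum_congr rfl fun i _ => Finset.sum_comm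
    _ = ∑ k, ∑ i, ∑ j, c i * c j * (|x i k - x j k| : ℝ) := Finset.sum_comm

/-- **`ℓ¹` is of negative type on `ℤ³`**: for `x : Fin n → ℤ³` and real weights with `Σ c_i = 0`,
`Σ_{i,j} c_i c_j ‖x_i − x_j‖₁ ≤ 0`. [cite: DezaLaurent1997, §6.1 (ℓ¹ ↪ cut cone ⊆ NEG)] -/
theorem sum_sum_mul_l1_nonpos {n : ℕ} (x : Fin n → Site 3) (c : Fin n → ℝ) (hc : ∑ i, c i = 0) :
    ∑ i, ∑ j, c i * c j * (∑ k, (|x i k - x j k| : ℝ)) ≤ 0 := by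
  rw [sum_sum_mul_sum_eq_sum_coord x c]
  exact Finset.sum_nonpos fun k _ => sum_sum_mul_abs_sub_nonpos (fun i => x i k) c hc

/-- **Null directions of the `ℓ¹` form.**  If `Σ c_i = 0` and `Σ_{i,j} c_i c_j ‖x_i − x_j‖₁ = 0` then every axis-level sum
vanishes: `Σ_{i : x_i k = v} c_i = 0` for all `k` and `v` (the cumulative sums `Σ_i c_i 1[x_i k ≤ t]` are the square roots of
the terms of the cut decomposition). [cite: DezaLaurent1997, §6.1] -/
theorem levelSum_eq_zero_of_l1Form_eq_zero {n : ℕ} (x : Fin n → Site 3) (c : Fin n → ℝ) (hc : ∑ i, c i = 0)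
    (h0 : ∑ i, ∑ j, c i * c j * (∑ k, (|x i k - x j k| : ℝ)) = 0) (k : Fin 3) (v : ℤ) :
    ∑ i ∈ Finset.univ.filter (fun i => x i k = v), c i = 0 := by
  -- each coordinate form is `≤ 0` and they sum to `0`, so each is `0`
  have hk : ∀ k, ∑ i, ∑ j, c i * c j * (|x i k - x j k| : ℝ) ≤ 0 :=
    fun k => sum_sum_mul_abs_sub_nonpos (fun i => x i k) c hc
  have hk0 : ∑ i, ∑ j, c i * c j * (|x i k - x j k| : ℝ) = 0 := by
    have h0' := h0
    rw [sum_sum_mul_sum_eq_sum_coord x c] at h0'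
    exact (Finset.sum_eq_zero_iff_of_nonpos fun k _ => hk k).1 h0' k (Finset.mem_univ k)
  -- the cumulative sums vanish on a window of cuts containing all points and `v`, `v - 1`
  set B : ℤ := ∑ i, |x i k| + |v| + 1 with hB
  have hle : ∀ i, |x i k| ≤ ∑ i, |x i k| :=
    fun i => Finset.single_le_sum (f := fun i => |x i k|) (fun i _ => abs_nonneg _) (Finset.mem_univ i)
  have hm : ∀ i, -B ≤ x i k := fun i => by
    have := hle i; have := neg_abs_le (x i k); have := abs_nonneg v; linarith
  have hM : ∀ i, x i k < B + 1 := fun i => by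
    have := hle i; have := le_abs_self (x i k); have := abs_nonneg v; linarith
  have hcum : ∀ t ∈ Finset.Ico (-B) (B + 1), ∑ i, c i * (if x i k ≤ t then (1 : ℝ) else 0) = 0 := by
    have heq := sum_sum_mul_abs_sub_eq (fun i => x i k) c hc hm hM
    rw [hk0] at heq
    have hsum0 : ∑ t ∈ Finset.Ico (-B) (B + 1), (∑ i, c i * (if x i k ≤ t then (1 : ℝ) else 0)) ^ 2 = 0 := by
      linarith
    intro t ht
    exact (pow_eq_zero_iff two_ne_zero).1 ((Finset.sum_eq_zero_iff_of_nonneg fun t _ => sq_nonneg _).1 hsum0 t ht)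
  -- level sum at `v` = cumulative(v) − cumulative(v − 1)
  have h0B : (0 : ℤ) ≤ ∑ i, |x i k| := Finset.sum_nonneg fun i _ => abs_nonneg _
  have hv : v ∈ Finset.Ico (-B) (B + 1) := by
    rw [Finset.mem_Ico]; have := le_abs_self v; have := neg_abs_le v; constructor <;> linarith
  have hv1 : v - 1 ∈ Finset.Ico (-B) (B + 1) := by
    rw [Finset.mem_Ico]; have := le_abs_self v; have := neg_abs_le v; constructor <;> linarith
  have hdiff : ∑ i ∈ Finset.univ.filter (fun i => x i k = v), c i =
      ∑ i, c i * (if x i k ≤ v then (1 : ℝ) else 0) - ∑ i, c i * (if x i k ≤ v - 1 then (1 : ℝ) else 0) := by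
    rw [← Finset.sum_sub_distrib, Finset.sum_filter]
    refine Finset.sum_congr rfl fun i _ => ?_
    by_cases h1 : x i k = v
    · have h2 : x i k ≤ v := h1.le
      have h3 : ¬ x i k ≤ v - 1 := by omega
      rw [if_pos h1, if_pos h2, if_neg h3]; ring
    · by_cases h2 : x i k ≤ v
      · have h3 : x i k ≤ v - 1 := by omega
        rw [if_neg h1, if_pos h2, if_pos h3]; ring
      · have h3 : ¬ x i k ≤ v - 1 := by omega
        rw [if_neg h1, if_neg h2, if_neg h3]; ring
  rw [hdiff, hcum v hv, hcum (v - 1) hv1, sub_zero]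

/-- On the null directions every kernel depending on ONE coordinate pair vanishes:
if all `k`-level sums of `c` vanish then `Σ_{i,j} c_i c_j F(x_i k, x_j k) = 0` for every `F`. [folklore] -/
theorem sum_sum_coord_eq_zero {n : ℕ} (x : Fin n → Site 3) (c : Fin n → ℝ) (k : Fin 3)
    (hlev : ∀ v : ℤ, ∑ i ∈ Finset.univ.filter (fun i => x i k = v), c i = 0) (F : ℤ → ℤ → ℝ) :
    ∑ i, ∑ j, c i * c j * F (x i k) (x j k) = 0 := by
  have hinner : ∀ i, ∑ j, c i * c j * F (x i k) (x j k) = 0 := by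
    intro i
    have h1 : ∑ j, c i * c j * F (x i k) (x j k) = ∑ j, (c i * F (x i k) (x j k)) * c j :=
      Finset.sum_congr rfl fun j _ => by ring
    rw [h1, ← Finset.sum_fiberwise_of_maps_to (s := Finset.univ) (t := Finset.univ.image fun j => x j k)
      (g := fun j => x j k) (fun j hj => Finset.mem_image_of_mem _ hj)]
    refine Finset.sum_eq_zero fun v _ => ?_
    have h2 : ∑ j ∈ Finset.univ.filter (fun j => x j k = v), (c i * F (x i k) (x j k)) * c j =
        (c i * F (x i k) v) * ∑ j ∈ Finset.univ.filter (fun j => x j k = v), c j := by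
      rw [Finset.mul_sum]
      refine Finset.sum_congr rfl fun j hj => ?_
      rw [(Finset.mem_filter.1 hj).2]
    rw [h2, hlev v, mul_zero]
  exact Finset.sum_eq_zero fun i _ => hinner i

/-! ### The kernels `r^{‖x − y‖₁}` (`0 ≤ r ≤ 1`) are positive semi-definite -/

/-- One-dimensional Gram expansion of `r^{|a−b|}` on `{0,…,M}` (covariance of a geometric walk killed at independent cuts):
`r^{|a−b|} = r^{a+b} + (1 − r²) Σ_{1 ≤ s ≤ min(a,b)} r^{a−s} r^{b−s}`, written as one sum over `s ∈ {0,…,M}`.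
[cite: BergChristensenRessel1984, Ch. 3 §1 (positive definite kernels, Gram form)] -/
theorem pow_dist_eq_sum_gram (r : ℝ) {a b M : ℕ} (ha : a ≤ M) (hb : b ≤ M) :
    r ^ ((a - b) + (b - a)) = ∑ s ∈ Finset.range (M + 1),
      (if s = 0 then (1 : ℝ) else 1 - r ^ 2) *
        ((if s = 0 then r ^ a else if s - 1 < a then r ^ (a - s) else 0) *
         (if s = 0 then r ^ b else if s - 1 < b then r ^ (b - s) else 0)) := by
  wlog hab : a ≤ b generalizing a b
  · have h := this hb ha (le_of_not_ge hab)
    rw [add_comm, h]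
    exact Finset.sum_congr rfl fun s _ => by ring
  rw [Finset.sum_range_succ', if_pos rfl, if_pos rfl, if_pos rfl, one_mul]
  have hterm : ∀ s ∈ Finset.range M, (if s + 1 = 0 then (1 : ℝ) else 1 - r ^ 2) *
      ((if s + 1 = 0 then r ^ a else if s + 1 - 1 < a then r ^ (a - (s + 1)) else 0) *
       (if s + 1 = 0 then r ^ b else if s + 1 - 1 < b then r ^ (b - (s + 1)) else 0)) =
      if s < a then r ^ ((a - (s + 1)) + (b - (s + 1))) - r ^ ((a - s) + (b - s)) else 0 := by
    intro s _
    rw [if_neg (show s + 1 ≠ 0 by omega), if_neg (show s + 1 ≠ 0 by omega), if_neg (show s + 1 ≠ 0 by omega),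
      Nat.add_sub_cancel]
    by_cases h1 : s < a
    · have h2 : s < b := lt_of_lt_of_le h1 hab
      rw [if_pos h1, if_pos h2, if_pos h1, ← pow_add]
      have e1 : (a - s) + (b - s) = ((a - (s + 1)) + (b - (s + 1))) + 2 := by omega
      rw [e1, pow_add]
      ring
    · rw [if_neg h1, zero_mul, mul_zero, if_neg h1]
  rw [Finset.sum_congr rfl hterm, ← Finset.sum_filter]
  have hf : (Finset.range M).filter (fun s => s < a) = Finset.range a := by
    ext s
    simp only [Finset.mem_filter, Finset.mem_range]
    omega
  rw [hf, Finset.sum_range_sub (fun s => r ^ ((a - s) + (b - s))) a]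
  simp only [Nat.sub_self, Nat.sub_zero, zero_add, Nat.sub_eq_zero_of_le hab]
  rw [← pow_add]
  ring

/-- **`r^{‖x−y‖₁}` is a positive semi-definite kernel on `ℤ³`** for `0 ≤ r ≤ 1`: `Σ_{i,j} c_i c_j r^{‖x_i − x_j‖₁} ≥ 0`
(product over the three coordinates of the one-dimensional Gram expansions; Schur's product theorem by expansion).
[cite: BergChristensenRessel1984, Ch. 3, Thm 1.12 (products of positive definite kernels)] [cite: Schoenberg1938] -/
theorem sum_sum_mul_pow_l1_nonneg {n : ℕ} (x : Fin n → Site 3) (c : Fin n → ℝ) {r : ℝ} (hr1 : r ≤ 1) (hr1' : -1 ≤ r) :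
    0 ≤ ∑ i, ∑ j, c i * c j * r ^ (∑ k, (x i k - x j k).natAbs) := by
  -- shift to natural coordinates in `{0, …, M}`
  set B : ℤ := ∑ i, ∑ k, |x i k| with hB
  have hle : ∀ i k, |x i k| ≤ B := by
    intro i k
    calc |x i k| ≤ ∑ k, |x i k| := Finset.single_le_sum (f := fun k => |x i k|) (fun k _ => abs_nonneg _) (Finset.mem_univ k)
      _ ≤ B := Finset.single_le_sum (f := fun i => ∑ k, |x i k|)
          (fun i _ => Finset.sum_nonneg fun k _ => abs_nonneg _) (Finset.mem_univ i)
  set a : Fin n → Fin 3 → ℕ := fun i k => (x i k + B).toNat with ha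
  set M : ℕ := (2 * B).toNat with hM
  have haM : ∀ i k, a i k ≤ M := by
    intro i k
    have h1 := hle i k; have h2 := le_abs_self (x i k)
    simp only [ha, hM]
    omega
  have hdist : ∀ i j k, (x i k - x j k).natAbs = (a i k - a j k) + (a j k - a i k) := by
    intro i j k
    have h1 := hle i k; have h2 := hle j k
    have h3 := neg_abs_le (x i k); have h4 := neg_abs_le (x j k)
    simp only [ha]
    omega
  -- the Gram data
  set w : ℕ → ℝ := fun s => if s = 0 then (1 : ℝ) else 1 - r ^ 2 with hw
  set φ : ℕ → ℕ → ℝ := fun s t => if s = 0 then r ^ t else if s - 1 < t then r ^ (t - s) else 0 with hφ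
  have hw0 : ∀ s, 0 ≤ w s := by
    intro s
    simp only [hw]
    split_ifs
    · norm_num
    · nlinarith
  set S := Fintype.piFinset (fun _ : Fin 3 => Finset.range (M + 1)) with hS
  have hker : ∀ i j, r ^ (∑ k, (x i k - x j k).natAbs) =
      ∑ σ ∈ S, (∏ k, w (σ k)) * ((∏ k, φ (σ k) (a i k)) * (∏ k, φ (σ k) (a j k))) := by
    intro i j
    rw [← Finset.prod_pow_eq_pow_sum]
    have h1 : ∀ k, r ^ (x i k - x j k).natAbs = ∑ s ∈ Finset.range (M + 1), w s * (φ s (a i k) * φ s (a j k)) := by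
      intro k
      rw [hdist]
      exact pow_dist_eq_sum_gram r (haM i k) (haM j k)
    simp_rw [h1]
    rw [Finset.prod_univ_sum (fun _ : Fin 3 => Finset.range (M + 1)) (fun k s => w s * (φ s (a i k) * φ s (a j k)))]
    refine Finset.sum_congr rfl fun σ _ => ?_
    rw [Finset.prod_mul_distrib, Finset.prod_mul_distrib]
  have hrew : ∑ i, ∑ j, c i * c j * r ^ (∑ k, (x i k - x j k).natAbs) =
      ∑ σ ∈ S, (∏ k, w (σ k)) * (∑ i, c i * ∏ k, φ (σ k) (a i k)) ^ 2 := by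
    calc ∑ i, ∑ j, c i * c j * r ^ (∑ k, (x i k - x j k).natAbs)
        = ∑ i, ∑ j, ∑ σ ∈ S, c i * c j * ((∏ k, w (σ k)) * ((∏ k, φ (σ k) (a i k)) * (∏ k, φ (σ k) (a j k)))) := by
          refine Finset.sum_congr rfl fun i _ => Finset.sum_congr rfl fun j _ => ?_
          rw [hker, Finset.mul_sum]
      _ = ∑ i, ∑ σ ∈ S, ∑ j, c i * c j * ((∏ k, w (σ k)) * ((∏ k, φ (σ k) (a i k)) * (∏ k, φ (σ k) (a j k)))) :=
          Finset.sum_congr rfl fun i _ => Finset.sum_comm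
      _ = ∑ σ ∈ S, ∑ i, ∑ j, c i * c j * ((∏ k, w (σ k)) * ((∏ k, φ (σ k) (a i k)) * (∏ k, φ (σ k) (a j k)))) :=
          Finset.sum_comm
      _ = ∑ σ ∈ S, (∏ k, w (σ k)) * (∑ i, c i * ∏ k, φ (σ k) (a i k)) ^ 2 := by
          refine Finset.sum_congr rfl fun σ _ => ?_
          rw [sq, Finset.sum_mul_sum, Finset.mul_sum]
          refine Finset.sum_congr rfl fun i _ => ?_
          rw [Finset.mul_sum]
          refine Finset.sum_congr rfl fun j _ => ?_
          ring
  rw [hrew]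
  exact Finset.sum_nonneg fun σ _ => mul_nonneg (Finset.prod_nonneg fun k _ => hw0 _) (sq_nonneg _)

end SmallPNegType

end Summit.CriticalPhenomena.PercolationContinuityZ3.Theorems

end
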